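import Mathlib

/-!
# Couple identity (ENGINE B, pub-hlocus abs-2 g49) — helper anchor

certified instances and evidence bearing on the general Hodge conjecture; no claim.

Combinatorial heart of the `couple identity' of the ζ₃ pair census (DERIVATIONS_engineB §66.15 (c)):
class pairs `p` of a horizon group come in couples `{p, s p}` (`s` an involution) and the deep levels
satisfy the two isosceles consequences
* `H < ℓ p → ℓ (s p) = H` and
* `ℓ p = H → H ≤ ℓ (s p)`.
Then `#{ℓ = H} = #{ℓ > H} + #{p : ℓ p = H ∧ ℓ (s p) = H}` (the last set is the union of the
`equidistant couples', of even size `2E`).  Purely finite combinatorics; the ultrametric input is in the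
two hypotheses.
-/

set_option linter.dupNamespace false

namespace Summit.HodgeConjecture.HodgeConjecture.HodgeLocus.Census.CoupleIdentityB

open Finset

variable {α : Type*} [Fintype α] [DecidableEq α]

omit [Fintype α] [DecidableEq α] in
/-- Below the horizon the couple partner is below the horizon as well. -/
theorem partner_below (s : α → α) (hs : ∀ p, s (s p) = p) (ℓ : α → ℕ) (H : ℕ)
    (h1 : ∀ p, H < ℓ p → ℓ (s p) = H) (h2 : ∀ p, ℓ p = H → H ≤ ℓ (s p))
    (p : α) (hp : ℓ p < H) : ℓ (s p) < H := by
  by_contra hc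
  rw [Nat.not_lt] at hc
  rcases hc.lt_or_eq with hlt | heq
  · have h := h1 (s p) hlt
    rw [hs] at h
    omega
  · have h := h2 (s p) heq.symm
    rw [hs] at h
    omega

/-- The couple identity: `N(ℓ = H) = N(ℓ > H) + #{p : ℓ p = H ∧ ℓ (s p) = H}`. -/
theorem couple_identity (s : α → α) (hs : ∀ p, s (s p) = p) (ℓ : α → ℕ) (H : ℕ)
    (h1 : ∀ p, H < ℓ p → ℓ (s p) = H) (h2 : ∀ p, ℓ p = H → H ≤ ℓ (s p)) :
    (univ.filter (fun p => ℓ p = H)).card =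
      (univ.filter (fun p => H < ℓ p)).card +
        (univ.filter (fun p => ℓ p = H ∧ ℓ (s p) = H)).card := by
  have hsplit : univ.filter (fun p => ℓ p = H) =
      (univ.filter (fun p => ℓ p = H ∧ H < ℓ (s p))) ∪
        (univ.filter (fun p => ℓ p = H ∧ ℓ (s p) = H)) := by
    ext p
    simp only [mem_filter, mem_univ, true_and, mem_union]
    constructor
    · intro hp
      rcases (h2 p hp).lt_or_eq with h | h
      · exact Or.inl ⟨hp, h⟩
      · exact Or.inr ⟨hp, h.symm⟩
    · rintro (⟨hp, -⟩ | ⟨hp, -⟩) <;> exact hp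
  have hdisj : Disjoint (univ.filter (fun p => ℓ p = H ∧ H < ℓ (s p)))
      (univ.filter (fun p => ℓ p = H ∧ ℓ (s p) = H)) := by
    rw [disjoint_filter]
    intro p _ ha hb
    omega
  rw [hsplit, card_union_of_disjoint hdisj]
  congr 1
  apply card_bij (fun p _ => s p)
  · intro p hp
    simp only [mem_filter, mem_univ, true_and] at hp ⊢
    exact hp.2
  · intro p hp q hq h
    have := congrArg s h
    simpa [hs] using this
  · intro q hq
    simp only [mem_filter, mem_univ, true_and] at hq
    refine ⟨s q, ?_, hs q⟩
    simp only [mem_filter, mem_univ, true_and]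
    refine ⟨h1 q hq, ?_⟩
    rw [hs]
    exact hq

/-- Sanity instance: four points, involution swapping 0↔1 and 2↔3, levels (7, 5, 5, 5), H = 5:
N(=5) = 3 = N(>5) + #{both = 5} = 1 + 2. -/
example : (univ.filter (fun p : Fin 4 => (![7, 5, 5, 5] : Fin 4 → ℕ) p = 5)).card =
    (univ.filter (fun p : Fin 4 => 5 < (![7, 5, 5, 5] : Fin 4 → ℕ) p)).card +
      (univ.filter (fun p : Fin 4 => (![7, 5, 5, 5] : Fin 4 → ℕ) p = 5 ∧
        (![7, 5, 5, 5] : Fin 4 → ℕ) ((![1, 0, 3, 2] : Fin 4 → Fin 4) p) = 5)).card := by decide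

end Summit.HodgeConjecture.HodgeConjecture.HodgeLocus.Census.CoupleIdentityB
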